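import Mathlib.Data.Nat.Choose.Basic
import Mathlib.Algebra.BigOperators.Intervals
import Mathlib.Algebra.Order.BigOperators.Group.Finset
import Mathlib.Tactic
import Summits.CriticalPhenomena.PercolationContinuityZ3.Theorems.PercNearOneGluingNoHeavyLowerTailOneBlock
import HarnessLib

/-!
# CONJECTURE U without buffer (`L = 0`): the one-block inequalities in a common index

Support file for the Sahi / Conjecture-P programme of route `PercNearOneGluingNoHeavy`
(`--supports stmt-CriticalPhenomena-4575`, prover prim-l12-p5 gen 28; proof note
`prim-l12-p5/U-PROOF-g28.md` §4, Proposition Z).  No definitions, no named facts, no sorries.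

Two complementary blocks of `M₁` and `n` fair coins, `K` heads in total, `2K + j = M₁ + n`; index `h` = heads
in the `n`-block (so `x₁ = K - h` heads in the `M₁`-block), `P(h) = C(n,h) C(M₁,K-h)`,
`f(h) = κ₀ - (2h-n)(2h-n+j) = κ₀ + d₁ d₂`.

* `reindex` : `∑_{x ≤ M} [x ≤ K] Ψ(x, K-x) = ∑_{h ≤ n} [h ≤ K, K-h ≤ M] Ψ(K-h, h)` (change of index `h = K - x`);
* `ob_h`, `ob_x` : the one-block inequality `OneBlock.one_block` for a window on the `n`-block (in `h`) and for
  a window on the `M₁`-block (re-indexed to `h`);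
* `quad_three_point` : the three-point identity of the concave parabola `f`.
Proposition Z itself (both blocks windowed) is assembled from these in `…UZero`.
-/

namespace Summit.CriticalPhenomena.PercolationContinuityZ3.Theorems

namespace UZeroBase

open Finset

/-- Change of index `h = K - x` between a block and its complement; terms with `h > n` must vanish. -/
theorem reindex (M K n : ℕ) (Ψ : ℕ → ℕ → ℝ) (hΨ : ∀ x h, n < h → Ψ x h = 0) :
    ∑ x ∈ range (M + 1), (if x ≤ K then Ψ x (K - x) else 0) =
      ∑ h ∈ range (n + 1), (if h ≤ K ∧ K - h ≤ M then Ψ (K - h) h else 0) := by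
  apply Finset.sum_bij_ne_zero (fun x _ _ => K - x)
  · intro x hx hne
    have hxK : x ≤ K := by
      by_contra hc
      rw [if_neg hc] at hne
      exact hne rfl
    rw [if_pos hxK] at hne
    have : K - x ≤ n := by
      by_contra hc
      push Not at hc
      exact hne (hΨ x (K - x) hc)
    exact mem_range.mpr (by omega)
  · intro x₁ hx₁ hne₁ x₂ hx₂ hne₂ heq
    have h1 : x₁ ≤ K := by
      by_contra hc
      rw [if_neg hc] at hne₁
      exact hne₁ rfl
    have h2 : x₂ ≤ K := by
      by_contra hc
      rw [if_neg hc] at hne₂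
      exact hne₂ rfl
    have heq' : K - x₁ = K - x₂ := heq
    omega
  · intro h hh hne
    have hc : h ≤ K ∧ K - h ≤ M := by
      by_contra hc
      rw [if_neg hc] at hne
      exact hne rfl
    rw [if_pos hc] at hne
    refine ⟨K - h, mem_range.mpr (by omega), ?_, Nat.sub_sub_self hc.1⟩
    have e : K - (K - h) = h := by omega
    rw [if_pos (show K - h ≤ K by omega), e]
    exact hne
  · intro x hx hne
    have hxK : x ≤ K := by
      by_contra hc
      rw [if_neg hc] at hne
      exact hne rfl
    have hxM : x ≤ M := by
      have := mem_range.mp hx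
      omega
    have e : K - (K - x) = x := by omega
    show (if x ≤ K then Ψ x (K - x) else 0) =
      (if K - x ≤ K ∧ K - (K - x) ≤ M then Ψ (K - (K - x)) (K - x) else 0)
    rw [if_pos hxK, e, if_pos ⟨by omega, hxM⟩]

/-- The one-block inequality for a centred window on the `n`-block, in the index `h`. -/
theorem ob_h (M₁ n K j : ℕ) (hK : 2 * K + j = M₁ + n) (hM : 1 ≤ M₁) (hn : 1 ≤ n) (κ₀ : ℝ) (hκ₀ : 0 ≤ κ₀)
    (hκ₀' : (M₁ : ℝ) * n * (((M₁ : ℝ) + n) - (j : ℝ) ^ 2) ≤ κ₀ * (((M₁ : ℝ) + n) * (((M₁ : ℝ) + n) - 1)))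
    (i : ℕ) :
    0 ≤ ∑ h ∈ range (n + 1), (if i ≤ h ∧ h ≤ n - i ∧ h ≤ K then
      (n.choose h : ℝ) * (M₁.choose (K - h) : ℝ) * (κ₀ - (2 * (h : ℝ) - n) * (2 * (h : ℝ) - n + j)) else 0) := by
  have hκ₀'' : (n : ℝ) * M₁ * (((n : ℝ) + M₁) - (j : ℝ) ^ 2) ≤ κ₀ * (((n : ℝ) + M₁) * (((n : ℝ) + M₁) - 1)) := by
    have e1 : (n : ℝ) * M₁ * (((n : ℝ) + M₁) - (j : ℝ) ^ 2) = (M₁ : ℝ) * n * (((M₁ : ℝ) + n) - (j : ℝ) ^ 2) := by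
      ring
    have e2 : κ₀ * (((n : ℝ) + M₁) * (((n : ℝ) + M₁) - 1)) = κ₀ * (((M₁ : ℝ) + n) * (((M₁ : ℝ) + n) - 1)) := by
      ring
    rw [e1, e2]
    exact hκ₀'
  have hob := OneBlock.one_block n M₁ K j (by omega) hn hM κ₀ hκ₀ hκ₀''
    (fun h => if i ≤ h ∧ h ≤ n - i then (1 : ℝ) else 0)
    (fun h => by split_ifs <;> norm_num)
    (fun h hh => by
      by_cases hc : i ≤ h ∧ h ≤ n - i
      · rw [if_pos hc, if_pos (show i ≤ n - h ∧ n - h ≤ n - i by omega)]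
      · rw [if_neg hc, if_neg (show ¬ (i ≤ n - h ∧ n - h ≤ n - i) by omega)])
    (fun h hh => by
      by_cases hc : i ≤ h ∧ h ≤ n - i
      · rw [if_pos hc, if_pos (show i ≤ h + 1 ∧ h + 1 ≤ n - i by omega)]
      · rw [if_neg hc]
        split_ifs <;> norm_num)
  have hKr : (2 : ℝ) * K = (M₁ : ℝ) + n - j := by
    have : ((2 * K + j : ℕ) : ℝ) = ((M₁ + n : ℕ) : ℝ) := by rw [hK]
    push_cast at this
    linarith
  have e : ∀ h ∈ range (n + 1), (n.choose h : ℝ) * (if i ≤ h ∧ h ≤ n - i then (1 : ℝ) else 0) *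
      (if h ≤ K then κ₀ * (M₁.choose (K - h) : ℝ) +
        (2 * (h : ℝ) - n) * ((M₁.choose (K - h) : ℝ) * (2 * ((K - h : ℕ) : ℝ) - M₁)) else 0) =
      (if i ≤ h ∧ h ≤ n - i ∧ h ≤ K then
        (n.choose h : ℝ) * (M₁.choose (K - h) : ℝ) * (κ₀ - (2 * (h : ℝ) - n) * (2 * (h : ℝ) - n + j)) else 0) := by
    intro h _
    by_cases hw : i ≤ h ∧ h ≤ n - i
    · rw [if_pos hw]
      by_cases hhK : h ≤ K
      · rw [if_pos hhK, if_pos ⟨hw.1, hw.2, hhK⟩]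
        push_cast [Nat.cast_sub hhK]
        rw [show ((M₁ : ℝ)) = 2 * K - n + j by linarith]
        ring
      · rw [if_neg hhK, if_neg (show ¬ (i ≤ h ∧ h ≤ n - i ∧ h ≤ K) from fun hc => hhK hc.2.2)]
        ring
    · rw [if_neg hw, if_neg (show ¬ (i ≤ h ∧ h ≤ n - i ∧ h ≤ K) from fun hc => hw ⟨hc.1, hc.2.1⟩)]
      ring
  rw [sum_congr rfl e] at hob
  exact hob

/-- The one-block inequality for a centred window on the `M₁`-block, re-indexed to `h = K - x₁`. -/
theorem ob_x (M₁ n K j : ℕ) (hK : 2 * K + j = M₁ + n) (hM : 1 ≤ M₁) (hn : 1 ≤ n) (κ₀ : ℝ) (hκ₀ : 0 ≤ κ₀)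
    (hκ₀' : (M₁ : ℝ) * n * (((M₁ : ℝ) + n) - (j : ℝ) ^ 2) ≤ κ₀ * (((M₁ : ℝ) + n) * (((M₁ : ℝ) + n) - 1)))
    (i₁ : ℕ) :
    0 ≤ ∑ h ∈ range (n + 1), (if h ≤ K ∧ i₁ ≤ K - h ∧ K - h ≤ M₁ - i₁ then
      (n.choose h : ℝ) * (M₁.choose (K - h) : ℝ) * (κ₀ - (2 * (h : ℝ) - n) * (2 * (h : ℝ) - n + j)) else 0) := by
  have hob := OneBlock.one_block M₁ n K j hK hM hn κ₀ hκ₀ hκ₀'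
    (fun x => if i₁ ≤ x ∧ x ≤ M₁ - i₁ then (1 : ℝ) else 0)
    (fun x => by split_ifs <;> norm_num)
    (fun x hx => by
      by_cases hc : i₁ ≤ x ∧ x ≤ M₁ - i₁
      · rw [if_pos hc, if_pos (show i₁ ≤ M₁ - x ∧ M₁ - x ≤ M₁ - i₁ by omega)]
      · rw [if_neg hc, if_neg (show ¬ (i₁ ≤ M₁ - x ∧ M₁ - x ≤ M₁ - i₁) by omega)])
    (fun x hx => by
      by_cases hc : i₁ ≤ x ∧ x ≤ M₁ - i₁
      · rw [if_pos hc, if_pos (show i₁ ≤ x + 1 ∧ x + 1 ≤ M₁ - i₁ by omega)]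
      · rw [if_neg hc]
        split_ifs <;> norm_num)
  have hKr : (2 : ℝ) * K = (M₁ : ℝ) + n - j := by
    have : ((2 * K + j : ℕ) : ℝ) = ((M₁ + n : ℕ) : ℝ) := by rw [hK]
    push_cast at this
    linarith
  -- write the summand as `if x ≤ K then Ψ x (K - x) else 0`
  set Ψ : ℕ → ℕ → ℝ := fun x h => if i₁ ≤ x ∧ x ≤ M₁ - i₁ then
    (n.choose h : ℝ) * (M₁.choose x : ℝ) * (κ₀ + (2 * (x : ℝ) - M₁) * (2 * (h : ℝ) - n)) else 0 with hΨ
  have e : ∀ x ∈ range (M₁ + 1), (M₁.choose x : ℝ) * (if i₁ ≤ x ∧ x ≤ M₁ - i₁ then (1 : ℝ) else 0) *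
      (if x ≤ K then κ₀ * (n.choose (K - x) : ℝ) +
        (2 * (x : ℝ) - M₁) * ((n.choose (K - x) : ℝ) * (2 * ((K - x : ℕ) : ℝ) - n)) else 0) =
      (if x ≤ K then Ψ x (K - x) else 0) := by
    intro x _
    by_cases hxK : x ≤ K
    · rw [if_pos hxK, if_pos hxK]
      show _ = (if i₁ ≤ x ∧ x ≤ M₁ - i₁ then
        (n.choose (K - x) : ℝ) * (M₁.choose x : ℝ) * (κ₀ + (2 * (x : ℝ) - M₁) * (2 * ((K - x : ℕ) : ℝ) - n))
        else 0)
      by_cases hw : i₁ ≤ x ∧ x ≤ M₁ - i₁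
      · rw [if_pos hw, if_pos hw]
        ring
      · rw [if_neg hw, if_neg hw]
        ring
    · rw [if_neg hxK, if_neg hxK]
      ring
  have hΨz : ∀ x h, n < h → Ψ x h = 0 := by
    intro x h hh
    show (if i₁ ≤ x ∧ x ≤ M₁ - i₁ then
      (n.choose h : ℝ) * (M₁.choose x : ℝ) * (κ₀ + (2 * (x : ℝ) - M₁) * (2 * (h : ℝ) - n)) else 0) = 0
    rw [Nat.choose_eq_zero_of_lt hh]
    split_ifs <;> simp
  rw [sum_congr rfl e, reindex M₁ K n Ψ hΨz] at hob
  have e2 : ∀ h ∈ range (n + 1), (if h ≤ K ∧ K - h ≤ M₁ then Ψ (K - h) h else 0) =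
      (if h ≤ K ∧ i₁ ≤ K - h ∧ K - h ≤ M₁ - i₁ then
        (n.choose h : ℝ) * (M₁.choose (K - h) : ℝ) * (κ₀ - (2 * (h : ℝ) - n) * (2 * (h : ℝ) - n + j)) else 0) := by
    intro h _
    by_cases hc : h ≤ K ∧ K - h ≤ M₁
    · rw [if_pos hc]
      show (if i₁ ≤ K - h ∧ K - h ≤ M₁ - i₁ then
        (n.choose h : ℝ) * (M₁.choose (K - h) : ℝ) * (κ₀ + (2 * ((K - h : ℕ) : ℝ) - M₁) * (2 * (h : ℝ) - n))
        else 0) = _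
      by_cases hw : i₁ ≤ K - h ∧ K - h ≤ M₁ - i₁
      · rw [if_pos hw, if_pos ⟨hc.1, hw.1, hw.2⟩]
        push_cast [Nat.cast_sub hc.1]
        rw [show ((M₁ : ℝ)) = 2 * K - n + j by linarith]
        ring
      · rw [if_neg hw, if_neg (fun hc' => hw ⟨hc'.2.1, hc'.2.2⟩)]
    · rw [if_neg hc, if_neg (fun hc' => hc ⟨hc'.1, by omega⟩)]
  rw [sum_congr rfl e2] at hob
  exact hob

/-- Three-point identity for the parabola `f(t) = κ₀ - (2t-n)(2t-n+j)`:
`(r-p) f(q) = (r-q) f(p) + (q-p) f(r) + 4(q-p)(r-q)(r-p)`. -/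
theorem quad_three_point (κ₀ nn jj p q r : ℝ) :
    (r - p) * (κ₀ - (2 * q - nn) * (2 * q - nn + jj)) =
      (r - q) * (κ₀ - (2 * p - nn) * (2 * p - nn + jj)) + (q - p) * (κ₀ - (2 * r - nn) * (2 * r - nn + jj)) +
        4 * (q - p) * (r - q) * (r - p) := by
  ring

end UZeroBase

end Summit.CriticalPhenomena.PercolationContinuityZ3.Theorems
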